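import Summits.Ventures.QEC.Census.CertCoverBatch
import Summits.Ventures.QEC.Census.BB.A1s_n168_k6_6e4c4458.CoreDefs
import HarnessLib

set_option Elab.async false
set_option maxRecDepth 200000

/-!
# `[[168,6,16]]` one-level cover certificate of `A1s_n168_k6_6e4c4458` — LEVEL-1→0 coset problems 269…297 (deep problems [5] excluded: `ProbDeep*.lean`) as COMPACT data
(`ProbData`: U, f, σ, y₀, allow; qec-type-10 `CertCoverBatch.mkCoset` rebuilds each `CosetProb` in the kernel) + their verdict
`probsOK cov covR hx hx1 D1 lxd 14` (one `decide +kernel`; 29 problems, depths f=0:27 f=1:2 f=2:0 f=3:0, est. 110.5 s).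
qec-search-1 g5 (pattern of search-9 g5 `Probs*`); data from JSON `level10.problems` (sha256 1581d825d337aa0f…). Data + decided check; KERNEL.
-/

namespace Summit.Ventures.QEC.Census.A1s_n168_k6_6e4c4458

open Matrix Summit.Ventures.QEC.Census Literature.InformationTheory.QuantumCodes

/-- Problems 269…297 (29): `⟨U, f, σ, y₀, allow⟩`. -/
def probs06 : List ProbData := [
    ⟨19013990487587279605760, 0, 55851360270, 18898698328313715236634, []⟩,
    ⟨19027836789242023905794, 0, 64454922258, 27672367910468191226, []⟩,
    ⟨19048578141550566455298, 0, 73031239691, 19046263291356462986514, []⟩,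
    ⟨19193931793190430448648, 0, 141750702164, 18889542501549944073216, []⟩,
    ⟨19489079733657234578432, 0, 279189672020, 9313488220409303546, []⟩,
    ⟨19509849165049050038282, 0, 287781161059, 18917244133980202205186, [0]⟩,
    ⟨21259946860946011981324, 0, 1103839103041, 2370480922870079815734, []⟩,
    ⟨23623402170587037568006, 0, 2203339200545, 9263904433776886302, []⟩,
    ⟨23625685517591566618627, 0, 2203339204624, 13835066854665619844, []⟩,
    ⟨23770953631618393716736, 0, 2272058689557, 18889483981074799279596, []⟩,
    ⟨24802225011349038438656, 0, 2753095541248, 5902959247080977080232, []⟩,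
    ⟨37862216948475490212880, 0, 38688268532, 94593184539090920, []⟩,
    ⟨37862239659979089944624, 0, 38688358664, 83298719454092911612, []⟩,
    ⟨37941534398491129839621, 0, 73050133540, 13839632033339440249, []⟩,
    ⟨38089108368621452689409, 0, 141769618468, 9259489362971761520, []⟩,
    ⟨38341643143259132789768, 0, 262026567756, 110689471641868568552, []⟩,
    ⟨38397086976009903804432, 0, 287796379816, 9268443424011853816, []⟩,
    ⟨38987382856943512064000, 0, 562674319528, 38959532490874004968436, []⟩,
    ⟨40302722143525043470340, 0, 1172559664171, 37932279430337990755124, []⟩,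
    ⟨40450296113655366320128, 0, 1241279149099, 2370442713204519895856, []⟩,
    ⟨47386249349834058268672, 0, 73058522132, 37941511810132975091468, []⟩,
    ⟨75862316214300604694538, 0, 141807388747, 75862307061980061105764, []⟩,
    ⟨76157464154561250394114, 0, 279246358603, 72234655161593980, []⟩,
    ⟨76163183826380345705480, 0, 279240119329, 76152771222567041107908, []⟩,
    ⟨76747760351363987669008, 0, 554120251465, 567348688062400, []⟩,
    ⟨85307014276038978502912, 0, 141810010154, 85011856237623062364412, []⟩,
    ⟨94751746116977871618048, 1, 141824165931, 94751736964665917963878, []⟩,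
    ⟨94825533234010214907904, 0, 176183969835, 94521125642003690913798, []⟩,
    ⟨152305615070079035377680, 1, 554187360321, 152305614502731706273744, []⟩]

set_option maxHeartbeats 400000000 in
/-- Every problem of this chunk passes (`mkCoset` elimination + `cosetOKD` + fast `σ` + depth + `BU`-evenness + label checks). -/
theorem probs06_ok : probsOK A1s_n168_k6_6e4c4458.cov covR hx hx1 D1 lxd 14 probs06 = true := by
  decide +kernel

/-- Pointwise form. -/
theorem probs06_all : ∀ x ∈ A1s_n168_k6_6e4c4458.probs06, probOK cov covR hx hx1 D1 lxd 14 x = true := by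
  have h := probs06_ok
  rwa [probsOK, List.all_eq_true] at h

end Summit.Ventures.QEC.Census.A1s_n168_k6_6e4c4458
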